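import Summits.QuantumAdvantage.AdviceFreeQNC0.PairSpeedNaming
import Summits.QuantumAdvantage.AdviceFreeQNC0.EliminationHardnessF
import HarnessLib

/-!
# Cell qa-qnc0 (odd primes), rung R7: `WalkHardFPairLocal p` — PAIR-LOCAL strategies lose, for every prime `p ≠ 3`

Planner qa-qnc0-p2 g15, ROUND-15 §3.4 / §7 (statement VERBATIM from `HOME/qa-qnc0-p2/line15/Sketch15R7.lean`):
the first DENSE class of the u-walk game.  A polylog-`𝔽_p`-degree strategy `y` in which some adjacent bit pair
`(a, a+1)` is read only by the cuts within distance `w ≤ (log₂ n)^C` of the pair (all other cuts are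
pair-independent; they may read everything else and fire `Θ(n)` times) wins on at most `(1 − η₀(p)/4)·2ⁿ`
inputs, `η₀(p)` the constant of `ElimHardF p` (`elimHardF`, prover file `EliminationHardnessF.lean`).
This contains every `w`-local strategy (take `a = ⌊n/2⌋`).

PROOF (`walkHardFPairLocal`; the three-speed parity argument of `PairSpeedFibre.lean`, replacing the memo's
`V₄` end-game lemma).  Parametrise inputs by the rest variable `v ∈ {0,1}^{n−2}` (right block complemented)
and the speed `t ∈ {0,1,2}` of the pair.  Summing the win parities over the three speeds kills every far cut
(it counts at exactly `0` or `2` speeds), and the near cuts contribute `M(v, 2|v| mod 3)` with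
`Σ_q M(v,q)` even; so the named phase `E(v)` (an even column) satisfies `2|v| ≡ E(v) ⇒` some speed loses
(`PairSpeed.exists_lose`).  `E` is determined by `≤ 8w+9` features of degree `≤ (log₂ n)^C`, so its level
sets have degree `≤ (8w+9)(log₂ n)^C ≤ (log₂ (n−2))^{2C+1}` for large `n` (`PairSpeed.levelSet_mem`), and
`ElimHardF p` on the `(n−2)`-cube gives `≥ η₀·2^{n−2}` rest inputs with `|v| ≡ 2E(v)`, i.e. `2|v| ≡ E(v)`;
distinct rest inputs give distinct losing inputs (`PairSpeed.emb_inj`), so `#win ≤ 2ⁿ − η₀·2^{n−2}`.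

WHAT THIS IS NOT: strategies in which EVERY pair is read from afar (the dense core; `DenseResidualSqrtOdd`
stmt-23029 minus R7) are untouched — OPEN; `p = 3` excluded (`ElimHardF 3` is false); separation NOT moved.
-/

noncomputable section

namespace Summit.QuantumAdvantage.AdviceFreeQNC0

open Classical
open Finset
open Literature.Computability.MetaComplexity Literature.Computability.MetaComplexity.Smolensky

/-- **`WalkHardFPairLocal p`** (rung R7, the first dense class; planner qa-qnc0-p2 g15 Sketch15R7, verbatim):
a polylog-degree strategy in which some adjacent bit pair `(a, a+1)` is read only by the cuts `g` with
`a - w ≤ g ≤ a + 2 + w`, `w ≤ (log₂ n)^C`, wins the u-walk game on at most `θ·2ⁿ` inputs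
(`θ = 1 - η₀(p)/4 + o(1)`). -/
def WalkHardFPairLocal (p : ℕ) [Fact p.Prime] : Prop :=
  ∃ θ : ℝ, θ < 1 ∧ ∀ C : ℕ, ∃ n₀ : ℕ, ∀ n ≥ n₀, ∀ c w a : ℕ,
    w ≤ (Nat.log 2 n) ^ C → a + 2 ≤ n →
    ∀ y : Fin (n + 1) → (Fin n → Bool) → Bool,
      (∀ g, HasDegF p (y g) ((Nat.log 2 n) ^ C)) →
      (∀ g : Fin (n + 1), (g.val + w < a ∨ a + 2 + w < g.val) →
        ∀ u v : Fin n → Bool, (∀ i : Fin n, i.val ≠ a → i.val ≠ a + 1 → u i = v i) → y g u = y g v) →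
      ((Finset.univ.filter fun u : Fin n → Bool => ringWinU c y u = true).card : ℝ) ≤ θ * (2 : ℝ) ^ n

namespace PairSpeed

/-- **Fibre count**: every rest input `v` with `2|v| ≡ E(v) (mod 3)` yields a LOSING input `emb t v`, and
distinct `v` yield distinct inputs. -/
theorem card_lose_ge {a q : ℕ} (c : ℕ) (y : Fin (a + 2 + q + 1) → (Fin (a + 2 + q) → Bool) → Bool) (w : ℕ)
    (hfar : ∀ g : Fin (a + 2 + q + 1), (g.val + w < a ∨ a + 2 + w < g.val) →
      ∀ u u' : Fin (a + 2 + q) → Bool, (∀ i : Fin (a + 2 + q), i.val ≠ a → i.val ≠ a + 1 → u i = u' i) →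
        y g u = y g u') :
    (univ.filter fun v : Fin (a + q) → Bool => (2 * wt v) % 3 = E c y w v).card ≤
      (univ.filter fun u : Fin (a + 2 + q) → Bool => ¬ (ringWinU c y u = true)).card := by
  have hch : ∀ v : Fin (a + q) → Bool, (2 * wt v) % 3 = E c y w v →
      ∃ t : Fin 3, ringWinU c y (emb t v) = false := fun v hv => exists_lose c y w hfar v hv
  let τ : (Fin (a + q) → Bool) → Fin 3 := fun v =>
    if h : (2 * wt v) % 3 = E c y w v then Classical.choose (hch v h) else 0
  have hτ : ∀ v, (2 * wt v) % 3 = E c y w v → ringWinU c y (emb (τ v) v) = false := by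
    intro v hv
    have e : τ v = Classical.choose (hch v hv) := dif_pos hv
    rw [e]
    exact Classical.choose_spec (hch v hv)
  refine Finset.card_le_card_of_injOn (fun v => emb (τ v) v) (fun v hv => ?_) (fun v _ v' _ h => emb_inj h)
  have hv' := (mem_filter.1 (mem_coe.1 hv)).2
  rw [mem_coe, mem_filter]
  refine ⟨mem_univ _, ?_⟩
  rw [hτ v hv']
  exact Bool.false_ne_true

/-- The degree budget: `(8w+9)·(log₂ n)^C ≤ (log₂ (n-2))^{2C+1}` once `log₂ (n-2) ≥ 17·4^C`. -/
theorem deg_budget {C ln lm w k : ℕ} (hk : k ≤ 8 * w + 9) (hw : w ≤ ln ^ C) (hln : ln ≤ 2 * lm)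
    (hln1 : 1 ≤ ln) (hbig : 17 * 4 ^ C ≤ lm) : k * ln ^ C ≤ lm ^ (2 * C + 1) := by
  have hlnC : 1 ≤ ln ^ C := Nat.one_le_pow _ _ hln1
  have hpow : ln ^ C ≤ 2 ^ C * lm ^ C := by
    rw [← mul_pow]; exact Nat.pow_le_pow_left hln C
  have h4 : (2 : ℕ) ^ C * 2 ^ C = 4 ^ C := by
    rw [← mul_pow]; norm_num
  calc k * ln ^ C ≤ (8 * w + 9) * ln ^ C := Nat.mul_le_mul_right _ hk
    _ ≤ (8 * ln ^ C + 9 * ln ^ C) * ln ^ C :=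
        Nat.mul_le_mul_right _ (by nlinarith)
    _ = 17 * (ln ^ C * ln ^ C) := by ring
    _ ≤ 17 * ((2 ^ C * lm ^ C) * (2 ^ C * lm ^ C)) :=
        Nat.mul_le_mul_left _ (Nat.mul_le_mul hpow hpow)
    _ = (17 * 4 ^ C) * (lm ^ C * lm ^ C) := by rw [← h4]; ring
    _ ≤ lm * (lm ^ C * lm ^ C) := Nat.mul_le_mul_right _ hbig
    _ = lm ^ (2 * C + 1) := by ring

end PairSpeed

open PairSpeed in
/-- **Rung R7 — `WalkHardFPairLocal p` holds for every prime `p ≠ 3`** (`θ = 1 − η₀(p)/4`, `η₀(p)` the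
constant of `elimHardF p`). -/
theorem walkHardFPairLocal (p : ℕ) [Fact p.Prime] (hp3 : p ≠ 3) : WalkHardFPairLocal p := by
  obtain ⟨η₀, hη₀, hE⟩ := elimHardF p hp3
  refine ⟨1 - η₀ / 4, by linarith, fun C => ?_⟩
  obtain ⟨n₁, hn₁⟩ := hE (2 * C + 1)
  refine ⟨max (n₁ + 2) (2 ^ (17 * 4 ^ C) + 2), fun n hn c w a hw han y hdeg hfar => ?_⟩
  obtain ⟨q, rfl⟩ : ∃ q, n = a + 2 + q := ⟨n - (a + 2), by omega⟩
  have hmax1 := le_max_left (n₁ + 2) (2 ^ (17 * 4 ^ C) + 2)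
  have hmax2 := le_max_right (n₁ + 2) (2 ^ (17 * 4 ^ C) + 2)
  have hn1 : n₁ ≤ a + q := by omega
  have hbig : 2 ^ (17 * 4 ^ C) ≤ a + q := by omega
  -- the two logarithms
  have hlm : 17 * 4 ^ C ≤ Nat.log 2 (a + q) := Nat.le_log_of_pow_le (by norm_num) hbig
  have h4C : 1 ≤ 4 ^ C := Nat.one_le_pow _ _ (by norm_num)
  have h217 : (2 : ℕ) ^ 17 ≤ 2 ^ (17 * 4 ^ C) := Nat.pow_le_pow_right (by norm_num) (by nlinarith)
  have haq2 : 2 ≤ a + q := by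
    have : (2 : ℕ) ≤ 2 ^ 17 := by norm_num
    omega
  have hln_le : Nat.log 2 (a + 2 + q) ≤ Nat.log 2 (a + q) + 1 := by
    calc Nat.log 2 (a + 2 + q) ≤ Nat.log 2 ((a + q) * 2) := Nat.log_mono_right (by omega)
      _ = Nat.log 2 (a + q) + 1 := Nat.log_mul_base (by norm_num) (by omega)
  have hln_ge : Nat.log 2 (a + q) ≤ Nat.log 2 (a + 2 + q) := Nat.log_mono_right (by omega)
  have hln1 : 1 ≤ Nat.log 2 (a + 2 + q) := by omega
  have hD1 : 1 ≤ Nat.log 2 (a + 2 + q) ^ C := Nat.one_le_pow _ _ hln1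
  -- degree budget
  have hdegle : (featSet (a := a) (q := q) w).card * Nat.log 2 (a + 2 + q) ^ C ≤
      Nat.log 2 (a + q) ^ (2 * C + 1) :=
    deg_budget (card_featSet_le (a := a) (q := q) w) hw (by omega) hln1 hlm
  -- level sets of the naming function `e := 2E` are of low degree on the rest cube
  have hlev : ∀ r : ℕ, (fun v : Fin (a + q) → Bool =>
      if (2 * E c y w v) % 3 = r % 3 then (1 : ZMod p) else 0) ∈
        lowDeg (ZMod p) (a + q) (Nat.log 2 (a + q) ^ (2 * C + 1)) := by
    intro r
    have h := levelSet_mem c y hD1 hdeg w ((2 * r) % 3)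
    have e : (fun v : Fin (a + q) → Bool => if (2 * E c y w v) % 3 = r % 3 then (1 : ZMod p) else 0) =
        fun v => if E c y w v = (2 * r) % 3 then (1 : ZMod p) else 0 := by
      funext v
      have hE3 := E_lt c y w v
      have hiff : (2 * E c y w v) % 3 = r % 3 ↔ E c y w v = (2 * r) % 3 := by omega
      simp only [hiff]
    rw [e]
    exact lowDeg_mono hdegle h
  -- `ElimHardF` on the rest cube
  have hcount := hn₁ (a + q) hn1 (fun v => 2 * E c y w v) hlev
  have hsub : (univ.filter fun v : Fin (a + q) → Bool => (2 * E c y w v) % 3 = Hegedus.wt v % 3) =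
      univ.filter fun v : Fin (a + q) → Bool => (2 * wt v) % 3 = E c y w v := by
    refine Finset.filter_congr fun v _ => ?_
    have hE3 := E_lt c y w v
    change (2 * E c y w v) % 3 = wt v % 3 ↔ _
    omega
  rw [hsub] at hcount
  have hlose := card_lose_ge c y w hfar
  -- WIN + LOSE = 2^n
  have htot := Finset.card_filter_add_card_filter_not
    (s := (univ : Finset (Fin (a + 2 + q) → Bool))) (fun u => ringWinU c y u = true)
  rw [card_univ, Fintype.card_fun, Fintype.card_bool, Fintype.card_fin] at htot
  have h2 : (2 : ℝ) ^ (a + 2 + q) = 4 * 2 ^ (a + q) := by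
    rw [show a + 2 + q = (a + q) + 2 by ring, pow_add]; ring
  have hL : η₀ * (2 : ℝ) ^ (a + q) ≤
      ((univ.filter fun u : Fin (a + 2 + q) → Bool => ¬ ringWinU c y u = true).card : ℝ) :=
    hcount.trans (by exact_mod_cast hlose)
  have hsum : ((univ.filter fun u : Fin (a + 2 + q) → Bool => ringWinU c y u = true).card : ℝ) +
      ((univ.filter fun u : Fin (a + 2 + q) → Bool => ¬ ringWinU c y u = true).card : ℝ) =
        (2 : ℝ) ^ (a + 2 + q) := by
    exact_mod_cast htot
  rw [h2] at hsum
  rw [h2]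
  nlinarith [hL, hη₀, hsum]

end Summit.QuantumAdvantage.AdviceFreeQNC0

end
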